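import Summits.CriticalPhenomena.PercolationContinuityZ3.Theorems.PercNearOneGluingNoHeavyLowerTailCubicThreePointFibreGladkov
import Literature.Probability.Percolation.GladkovZiminKernel
import Mathlib.Tactic.Ring
import Mathlib.Tactic.Linarith
import HarnessLib

/-!
# `NoHeavyLowerTail` (stmt-CriticalPhenomena-4575) — Gladkov's `AG ≥ 0` for EVERY finitary three-point law (arbitrary random edges `D`, weights
# `p ∈ [0,1]`, forced edges `K`), by the two-copy polar expansion

Support file (prover prim-sahi-p2, SAHI cell P2; `--supports stmt-CriticalPhenomena-4575`).  No definitions, no named facts, no sorries.  Companion of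
`…CubicThreePointFibreGladkov` (the pointwise ingredients `polar_eq_pattern`, `polar_shell`, `polar_transition_nonneg`, `ind_ev*_insert`,
`ind_cells_mixed_zero`).

WHAT.  In the finitary weighted calculus of `…CubicThreePointSections` (`PrW D p (ev… K a b c)`, the setting of prove-2's `shk3_of_stepHyp`, of THEOREM A
of `…TerminalClosure`, of the gluing theorems `TSP.*`), Gladkov's quadratic row had so far been available only through the measure-level
`prodBernoulli_threePoint_strongHarris` or on the class `TSP`.  Here:
* `twoCopy_polar_sum_nonneg` — for all `D, K` and `p ∈ [0,1]`:  `Σ_{S,T ⊆ D} w(S) w(T) · [AG(δ_K S + δ_K T) − AG(δ_K S) − AG(δ_K T)] ≥ 0`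
  (induction on `D`: exposing an edge `e` splits the double sum into the blocks `(S,T), (S+e,T), (S,T+e), (S+e,T+e)` with weights
  `(1−p_e)², p_e(1−p_e), p_e(1−p_e), p_e²`; the diagonal blocks are the sums for `(D∖e, K)` and `(D∖e, K ∪ {e})`, and the two mixed blocks dominate
  their sum by `polar_shell` + `polar_transition_nonneg` — Gladkov's step, weighted);
* **`AG_PrW_nonneg`** — `0 ≤ AG (PrW D p (evQ K a b c)) (PrW D p (evU₁ K a b c)) (PrW D p (evU₂ K a b c)) (PrW D p (evU₃ K a b c)) (PrW D p (evT K a b c))`,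
  i.e. `P(a|b|c)·P(abc) ≥ P(ab|c)P(ac|b) + P(ab|c)P(bc|a) + P(ac|b)P(bc|a)` for every finite weighted graph WITH FORCED EDGES, since `AG` of the law is half the
  two-copy polar sum (`two_mul_AG_PrW_eq`).
So the hypothesis `hag : 0 ≤ AG(cells)` of `F_edge_ab_nonneg`, `F_pendant_a_nonneg`, `Xi_coord_nonneg_of_sameSign`, … is discharged for every `(D, p, K)`.
[cite: Gladkov2024StrongFKG, Thm. 2.1 and Cor. 4.2 (the inequality and its one-coordinate proof)]
-/

noncomputable section

namespace Summit.CriticalPhenomena.PercolationContinuityZ3.Theorems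

namespace TerminalGluing

open Finset SimpleGraph Literature.Probability.Percolation Literature.Probability.Percolation.DecisionTree
open CubicThreePointStep CubicThreePointTerminal

variable {V : Type*} [DecidableEq V]

section TwoCopy

variable (a b c : V) {p : Sym2 V → ℝ} (hp0 : ∀ i, 0 ≤ p i) (hp1 : ∀ i, p i ≤ 1)
include hp0 hp1

omit hp0 hp1 in
/-- Exposing one coordinate in a weighted DOUBLE sum over configurations: the four blocks `(S,T), (S,T+e), (S+e,T), (S+e,T+e)` with weights
`(1−p_e)², (1−p_e)p_e, p_e(1−p_e), p_e²`. [folklore] -/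
theorem double_sum_insert {D : Finset (Sym2 V)} {e : Sym2 V} (heD : e ∉ D) (F : Finset (Sym2 V) → Finset (Sym2 V) → ℝ) :
    ∑ S ∈ (insert e D).powerset, ∑ T ∈ (insert e D).powerset, wtW (insert e D) p S * wtW (insert e D) p T * F S T =
      (1 - p e) * (1 - p e) * ∑ S ∈ D.powerset, ∑ T ∈ D.powerset, wtW D p S * wtW D p T * F S T
      + (1 - p e) * p e * ∑ S ∈ D.powerset, ∑ T ∈ D.powerset, wtW D p S * wtW D p T * F S (insert e T)
      + p e * (1 - p e) * ∑ S ∈ D.powerset, ∑ T ∈ D.powerset, wtW D p S * wtW D p T * F (insert e S) T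
      + p e * p e * ∑ S ∈ D.powerset, ∑ T ∈ D.powerset, wtW D p S * wtW D p T * F (insert e S) (insert e T) := by
  have hwS : ∀ S ∈ D.powerset, wtW (insert e D) p S = (1 - p e) * wtW D p S := fun S hS =>
    wtW_insert_of_notMem p heD (fun h => heD (Finset.mem_powerset.1 hS h))
  have hwSe : ∀ S : Finset (Sym2 V), wtW (insert e D) p (insert e S) = p e * wtW D p S := fun S => wtW_insert_insert p heD S
  simp only [Finset.sum_powerset_insert heD, Finset.sum_add_distrib]
  have hA : ∑ S ∈ D.powerset, ∑ T ∈ D.powerset, wtW (insert e D) p S * wtW (insert e D) p T * F S T =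
      (1 - p e) * (1 - p e) * ∑ S ∈ D.powerset, ∑ T ∈ D.powerset, wtW D p S * wtW D p T * F S T := by
    rw [Finset.mul_sum]; refine Finset.sum_congr rfl fun S hS => ?_
    rw [Finset.mul_sum]; refine Finset.sum_congr rfl fun T hT => ?_
    rw [hwS S hS, hwS T hT]; ring
  have hB : ∑ S ∈ D.powerset, ∑ T ∈ D.powerset, wtW (insert e D) p S * wtW (insert e D) p (insert e T) * F S (insert e T) =
      (1 - p e) * p e * ∑ S ∈ D.powerset, ∑ T ∈ D.powerset, wtW D p S * wtW D p T * F S (insert e T) := by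
    rw [Finset.mul_sum]; refine Finset.sum_congr rfl fun S hS => ?_
    rw [Finset.mul_sum]; refine Finset.sum_congr rfl fun T _ => ?_
    rw [hwS S hS, hwSe T]; ring
  have hC : ∑ S ∈ D.powerset, ∑ T ∈ D.powerset, wtW (insert e D) p (insert e S) * wtW (insert e D) p T * F (insert e S) T =
      p e * (1 - p e) * ∑ S ∈ D.powerset, ∑ T ∈ D.powerset, wtW D p S * wtW D p T * F (insert e S) T := by
    rw [Finset.mul_sum]; refine Finset.sum_congr rfl fun S _ => ?_
    rw [Finset.mul_sum]; refine Finset.sum_congr rfl fun T hT => ?_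
    rw [hwSe S, hwS T hT]; ring
  have hD' : ∑ S ∈ D.powerset, ∑ T ∈ D.powerset, wtW (insert e D) p (insert e S) * wtW (insert e D) p (insert e T) * F (insert e S) (insert e T) =
      p e * p e * ∑ S ∈ D.powerset, ∑ T ∈ D.powerset, wtW D p S * wtW D p T * F (insert e S) (insert e T) := by
    rw [Finset.mul_sum]; refine Finset.sum_congr rfl fun S _ => ?_
    rw [Finset.mul_sum]; refine Finset.sum_congr rfl fun T _ => ?_
    rw [hwSe S, hwSe T]; ring
  rw [hA, hB, hC, hD']
  ring

/-- **The weighted two-copy polar sum is nonnegative** (Gladkov's induction, weighted and with forced edges):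
`Σ_{S,T ⊆ D} w(S)w(T)[AG(δS+δT) − AG(δS) − AG(δT)] ≥ 0`. [cite: Gladkov2024StrongFKG, proof of Thm. 2.1] -/
theorem twoCopy_polar_sum_nonneg (D : Finset (Sym2 V)) : ∀ K : Finset (Sym2 V),
    0 ≤ ∑ S ∈ D.powerset, ∑ T ∈ D.powerset, wtW D p S * wtW D p T *
      (AG (ind (evQ K a b c) S + ind (evQ K a b c) T) (ind (evU₁ K a b c) S + ind (evU₁ K a b c) T)
          (ind (evU₂ K a b c) S + ind (evU₂ K a b c) T) (ind (evU₃ K a b c) S + ind (evU₃ K a b c) T)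
          (ind (evT K a b c) S + ind (evT K a b c) T)
        - AG (ind (evQ K a b c) S) (ind (evU₁ K a b c) S) (ind (evU₂ K a b c) S) (ind (evU₃ K a b c) S) (ind (evT K a b c) S)
        - AG (ind (evQ K a b c) T) (ind (evU₁ K a b c) T) (ind (evU₂ K a b c) T) (ind (evU₃ K a b c) T) (ind (evT K a b c) T)) := by
  induction D using Finset.induction_on with
  | empty =>
    intro K
    rw [Finset.powerset_empty, Finset.sum_singleton, Finset.sum_singleton, polar_eq_pattern]
    obtain ⟨h1, h2, h3, h4⟩ := ind_cells_mixed_zero a b c K (∅ : Finset (Sym2 V))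
    have hw : wtW (∅ : Finset (Sym2 V)) p ∅ = 1 := by simp [wtW]
    rw [hw]
    nlinarith [h1, h2, h3, h4, mul_comm (ind (evQ K a b c) ∅) (ind (evT K a b c) ∅),
      mul_comm (ind (evU₁ K a b c) ∅) (ind (evU₂ K a b c) ∅), mul_comm (ind (evU₁ K a b c) ∅) (ind (evU₃ K a b c) ∅),
      mul_comm (ind (evU₂ K a b c) ∅) (ind (evU₃ K a b c) ∅)]
  | @insert e D heD ih =>
    intro K
    have h0 := ih K
    have h1 := ih (insert e K)
    rw [double_sum_insert (p := p) heD]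
    simp only [ind_evQ_insert, ind_evU₁_insert, ind_evU₂_insert, ind_evU₃_insert, ind_evT_insert]
    have hpe0 : 0 ≤ p e := hp0 e
    have hpe1 : 0 ≤ 1 - p e := by linarith [hp1 e]
    -- the two mixed blocks together dominate `Φ(D,K) + Φ(D,K+e)` pointwise
    have key : ∀ S ∈ D.powerset, ∀ T ∈ D.powerset,
        wtW D p S * wtW D p T *
            (AG (ind (evQ K a b c) S + ind (evQ K a b c) T) (ind (evU₁ K a b c) S + ind (evU₁ K a b c) T)
                (ind (evU₂ K a b c) S + ind (evU₂ K a b c) T) (ind (evU₃ K a b c) S + ind (evU₃ K a b c) T)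
                (ind (evT K a b c) S + ind (evT K a b c) T)
              - AG (ind (evQ K a b c) S) (ind (evU₁ K a b c) S) (ind (evU₂ K a b c) S) (ind (evU₃ K a b c) S) (ind (evT K a b c) S)
              - AG (ind (evQ K a b c) T) (ind (evU₁ K a b c) T) (ind (evU₂ K a b c) T) (ind (evU₃ K a b c) T) (ind (evT K a b c) T))
        + wtW D p S * wtW D p T *
            (AG (ind (evQ (insert e K) a b c) S + ind (evQ (insert e K) a b c) T) (ind (evU₁ (insert e K) a b c) S + ind (evU₁ (insert e K) a b c) T)
                (ind (evU₂ (insert e K) a b c) S + ind (evU₂ (insert e K) a b c) T) (ind (evU₃ (insert e K) a b c) S + ind (evU₃ (insert e K) a b c) T)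
                (ind (evT (insert e K) a b c) S + ind (evT (insert e K) a b c) T)
              - AG (ind (evQ (insert e K) a b c) S) (ind (evU₁ (insert e K) a b c) S) (ind (evU₂ (insert e K) a b c) S)
                  (ind (evU₃ (insert e K) a b c) S) (ind (evT (insert e K) a b c) S)
              - AG (ind (evQ (insert e K) a b c) T) (ind (evU₁ (insert e K) a b c) T) (ind (evU₂ (insert e K) a b c) T)
                  (ind (evU₃ (insert e K) a b c) T) (ind (evT (insert e K) a b c) T)) ≤
        wtW D p S * wtW D p T *
            (AG (ind (evQ K a b c) S + ind (evQ (insert e K) a b c) T) (ind (evU₁ K a b c) S + ind (evU₁ (insert e K) a b c) T)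
                (ind (evU₂ K a b c) S + ind (evU₂ (insert e K) a b c) T) (ind (evU₃ K a b c) S + ind (evU₃ (insert e K) a b c) T)
                (ind (evT K a b c) S + ind (evT (insert e K) a b c) T)
              - AG (ind (evQ K a b c) S) (ind (evU₁ K a b c) S) (ind (evU₂ K a b c) S) (ind (evU₃ K a b c) S) (ind (evT K a b c) S)
              - AG (ind (evQ (insert e K) a b c) T) (ind (evU₁ (insert e K) a b c) T) (ind (evU₂ (insert e K) a b c) T)
                  (ind (evU₃ (insert e K) a b c) T) (ind (evT (insert e K) a b c) T))
        + wtW D p S * wtW D p T *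
            (AG (ind (evQ (insert e K) a b c) S + ind (evQ K a b c) T) (ind (evU₁ (insert e K) a b c) S + ind (evU₁ K a b c) T)
                (ind (evU₂ (insert e K) a b c) S + ind (evU₂ K a b c) T) (ind (evU₃ (insert e K) a b c) S + ind (evU₃ K a b c) T)
                (ind (evT (insert e K) a b c) S + ind (evT K a b c) T)
              - AG (ind (evQ (insert e K) a b c) S) (ind (evU₁ (insert e K) a b c) S) (ind (evU₂ (insert e K) a b c) S)
                  (ind (evU₃ (insert e K) a b c) S) (ind (evT (insert e K) a b c) S)
              - AG (ind (evQ K a b c) T) (ind (evU₁ K a b c) T) (ind (evU₂ K a b c) T) (ind (evU₃ K a b c) T) (ind (evT K a b c) T)) := by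
      intro S _ T _
      have hw : 0 ≤ wtW D p S * wtW D p T := mul_nonneg (wtW_nonneg D hp0 hp1 S) (wtW_nonneg D hp0 hp1 T)
      have hsh := polar_shell (ind (evQ K a b c) S) (ind (evU₁ K a b c) S) (ind (evU₂ K a b c) S) (ind (evU₃ K a b c) S) (ind (evT K a b c) S)
        (ind (evQ (insert e K) a b c) S) (ind (evU₁ (insert e K) a b c) S) (ind (evU₂ (insert e K) a b c) S) (ind (evU₃ (insert e K) a b c) S)
        (ind (evT (insert e K) a b c) S)
        (ind (evQ K a b c) T) (ind (evU₁ K a b c) T) (ind (evU₂ K a b c) T) (ind (evU₃ K a b c) T) (ind (evT K a b c) T)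
        (ind (evQ (insert e K) a b c) T) (ind (evU₁ (insert e K) a b c) T) (ind (evU₂ (insert e K) a b c) T) (ind (evU₃ (insert e K) a b c) T)
        (ind (evT (insert e K) a b c) T)
      have hΓ := polar_transition_nonneg (K := K) (a := a) (b := b) (c := c) (e := e) S T
      nlinarith [hsh, hΓ, hw]
    have hsum := Finset.sum_le_sum fun S hS => Finset.sum_le_sum fun T hT => key S hS T hT
    simp only [Finset.sum_add_distrib] at hsum
    -- hsum : Φ(D,K) + Φ(D,K+e) ≤ M₁ + M₂ (the two mixed blocks, unweighted by p); conclude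
    have hm : 0 ≤ p e * (1 - p e) := mul_nonneg hpe0 hpe1
    have hm' : (1 - p e) * p e = p e * (1 - p e) := mul_comm _ _
    rw [hm']
    nlinarith [hsum, h0, h1, mul_nonneg hm h0, mul_nonneg hm h1, mul_nonneg (mul_nonneg hpe1 hpe1) h0,
      mul_nonneg (mul_nonneg hpe0 hpe0) h1, hm]

omit hp0 hp1 in
/-- A product of two weighted sums as a double sum. [folklore] -/
theorem sum_mul_sum_wt (D : Finset (Sym2 V)) (f g : Finset (Sym2 V) → ℝ) :
    (∑ S ∈ D.powerset, wtW D p S * f S) * (∑ T ∈ D.powerset, wtW D p T * g T) =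
      ∑ S ∈ D.powerset, ∑ T ∈ D.powerset, wtW D p S * wtW D p T * (f S * g T) := by
  rw [Finset.sum_mul_sum]
  exact Finset.sum_congr rfl fun S _ => Finset.sum_congr rfl fun T _ => by ring

omit hp0 hp1 in
/-- `2·AG(law)` equals the weighted two-copy polar sum (expand the products of `PrW`'s; the pattern is already symmetric). [folklore] -/
theorem two_mul_AG_PrW_eq (D K : Finset (Sym2 V)) :
    2 * AG (PrW D p (evQ K a b c)) (PrW D p (evU₁ K a b c)) (PrW D p (evU₂ K a b c)) (PrW D p (evU₃ K a b c)) (PrW D p (evT K a b c)) =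
      ∑ S ∈ D.powerset, ∑ T ∈ D.powerset, wtW D p S * wtW D p T *
      (AG (ind (evQ K a b c) S + ind (evQ K a b c) T) (ind (evU₁ K a b c) S + ind (evU₁ K a b c) T)
          (ind (evU₂ K a b c) S + ind (evU₂ K a b c) T) (ind (evU₃ K a b c) S + ind (evU₃ K a b c) T)
          (ind (evT K a b c) S + ind (evT K a b c) T)
        - AG (ind (evQ K a b c) S) (ind (evU₁ K a b c) S) (ind (evU₂ K a b c) S) (ind (evU₃ K a b c) S) (ind (evT K a b c) S)
        - AG (ind (evQ K a b c) T) (ind (evU₁ K a b c) T) (ind (evU₂ K a b c) T) (ind (evU₃ K a b c) T) (ind (evT K a b c) T)) := by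
  rw [Finset.sum_congr rfl (fun S _ => Finset.sum_congr rfl (fun T _ => by rw [polar_eq_pattern]))]
  simp only [mul_add, mul_sub, Finset.sum_add_distrib, Finset.sum_sub_distrib]
  rw [← sum_mul_sum_wt D (ind (evQ K a b c)) (ind (evT K a b c)), ← sum_mul_sum_wt D (ind (evT K a b c)) (ind (evQ K a b c)),
    ← sum_mul_sum_wt D (ind (evU₁ K a b c)) (ind (evU₂ K a b c)), ← sum_mul_sum_wt D (ind (evU₂ K a b c)) (ind (evU₁ K a b c)),
    ← sum_mul_sum_wt D (ind (evU₁ K a b c)) (ind (evU₃ K a b c)), ← sum_mul_sum_wt D (ind (evU₃ K a b c)) (ind (evU₁ K a b c)),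
    ← sum_mul_sum_wt D (ind (evU₂ K a b c)) (ind (evU₃ K a b c)), ← sum_mul_sum_wt D (ind (evU₃ K a b c)) (ind (evU₂ K a b c))]
  simp only [← PrW_eq_sum_ind, AG]
  ring

/-- **Gladkov's three-point inequality for every finitary law with forced edges**: for all `D`, `K`, weights `p ∈ [0,1]` and terminals,
`0 ≤ AG(P(a|b|c), P(ab|c), P(ac|b), P(bc|a), P(abc))`, i.e. `P(a|b|c)·P(abc) ≥ P(ab|c)P(ac|b) + P(ab|c)P(bc|a) + P(ac|b)P(bc|a)`.
[cite: Gladkov2024StrongFKG, Cor. 4.2] -/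
theorem AG_PrW_nonneg (D K : Finset (Sym2 V)) :
    0 ≤ AG (PrW D p (evQ K a b c)) (PrW D p (evU₁ K a b c)) (PrW D p (evU₂ K a b c)) (PrW D p (evU₃ K a b c)) (PrW D p (evT K a b c)) := by
  have h := twoCopy_polar_sum_nonneg a b c hp0 hp1 D K
  rw [← two_mul_AG_PrW_eq] at h
  linarith

end TwoCopy

end TerminalGluing

end Summit.CriticalPhenomena.PercolationContinuityZ3.Theorems
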